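import Summits.BirchSwinnertonDyer.Rank1Residual.Additive.SignedConditionFromLocalKummer
import Summits.BirchSwinnertonDyer.Rank1Residual.Additive.StrictSignedInvariantClasses
import HarnessLib

/-!
# From the `K_∞`-signed condition of `A₀ = Sel^{loc,∞}` down to a Kummer cocycle over a FINITE layer
# — hypothesis (a) of the receptacle bridge (cell `b2b-bsdres`, CLASS-CLOSURE lane, class O10 —
# x1b GEN 39, class lead; file 86 of the series)

HONEST FRAMING (cell `b2b-bsdres`, run/shared/lean/b2b/bsd-rank1-residual/, verbatim in every
file): the goal of the cell is to DELETE the COMBINATION-SHAPED residual classes of the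
Birch–Swinnerton-Dyer formula for ALL analytic-rank `≤ 1` elliptic curves over `ℚ` — "full BSD
formula for every rank `≤ 1` curve in class `C`" assembled STRICTLY from published theorems — so
that the rank-`≤ 1` remainder becomes exactly the CONSTRUCTION-SHAPED classes, which are TYPED
(missing-input `Prop`s), NOT attempted. This is not "finishing BSD". CLASS-CLOSURE lane: prove
what is provable now; shrink each hard class to its core with data; no claim beyond stated classes;
research routes on CONSTRUCTION-SHAPED X12 / O10; census / instrument output = EVIDENCE / conjecture
items, NEVER a Literature fact; `RESIDUAL-MAP.md` marks change only by signed lines. THIS FILE: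
TOOL THEOREMS ONLY — no definition, no named Literature fact, no `sorry`, axioms standard; nothing
is booked; no label / mark / count / sub-cell moves; (C1_η), (C2_η-GZ), (C3_η) stay typed as filed
(cc-typer-6's pen); nothing about `BSD(W, p)` of any pair is claimed.

## What (the converse of file 85)

* `mem_strictSigned_of_pow_smul_mem`: `E^{−,str}(K_n·E)` is `p^j`-saturated in `E(K_n·E)` (Lemma 8.17
  + the torsion clause);
* `smul_eq_of_crossedHom_of_vanishing`: a crossed homomorphism vanishing on a normal subgroup `N`
  takes `N`-invariant values;
* **`exists_kummer_cocycle_of_mem_localKummerOverOfEmb_iSup_strictSigned`**: if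
  `h_0(Ψ_m c) ∈ localKummerOverOfEmb W p (ker κ) (closureEmb E) (⨆_n E^{−,str}(K_n·E))` (the signed
  part of `A₀ = Sel^{loc,∞}`, files 42–78), `E(K_∞·E)` has no `p`-power torsion and the `E(K_n·E)`
  no `p`-torsion (Prop. 8.7 — kernel for the lane's curves), then for some layer `n`, strict minus
  point `x ∈ E^{−,str}(K_n·E)` and `R` with `p^m R = x`, **`res_E c ∈ H¹(E, E[p^m])` is represented by
  a cocycle with values `u ↦ u•R − R` on `Gal(K̄_E/K_n·E)`** — the EXACT shape of x1b GEN 39 file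
  82's descended classes / of the receptacle SPEC (note §3 (iv)). Proof: the Kummer witness
  `(φ', Q, k)` on `ker κ` and a cocycle `φ₀` of `c` differ on `Gal(K̄/K_∞)` by a coboundary of some
  `T₀ ∈ E[p^∞]`, so `ι(φ₀(u|_K̄)) = uQ' − Q'` on `Gal(K̄_E/K_∞·E)` with `Q' = Q + ι(T₀)`; the defect
  `u ↦ ι(φ₀(u|_K̄)) − (uQ' − Q')` is a crossed homomorphism on `Γ_E` vanishing there, hence valued
  in `E(K_∞·E)`, and `p`-power torsion on `Gal(K̄_E/K_{n₁}·E)` (`p^k Q ∈ E^{−,str}(K_{n₁}·E)`), hence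
  zero; `x = p^m Q'` is `K_{n₁}·E`-rational and a `p`-power multiple of it is a strict minus point,
  so it is one (saturation).
So hypothesis (a) "`L = loc_{v₀}(Ψ_m⁻¹A₀) ≤ G`" of file 84 holds for ANY receptacle `G` containing
all classes of this shape; together with file 85 ((b)) the receptacle bridge applies to
`G = Σ_m` := {classes of this shape} and the count (C) can be re-assembled with `𝓖_{v₀} = p^{ν+e}·Σ_m`.

References: [Kobayashi2003] Def. 2.1 (p. 5), Prop. 8.7 (p. 16), Lemma 8.17 (p. 19), §9;
[GreenbergLNM1716] §3 pp. 85–86; [SerreGaloisCohomology1997] I.§5.8.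
-/

noncomputable section

open scoped Classical

open WeierstrassCurve Literature.NumberTheory.EllipticCurves Literature.NumberTheory.GaloisRepresentations
  NumberField IsDedekindDomain Field
open Literature.NumberTheory.EllipticCurves.Kobayashi2003
open Summit.BirchSwinnertonDyer.Rank1Residual.X11b.Levels
open Summit.BirchSwinnertonDyer.Rank1Residual.X11b
open scoped ContRepresentation

namespace Summit.BirchSwinnertonDyer.Rank1Residual.Additive.LevelBridge

universe u

section Saturation

variable {K : Type u} [Field K] {p : ℕ} [hp : Fact p.Prime] (κ : ZpExtension K p)
  {E : Type u} [Field E] [Algebra K E] (ι : AlgebraicClosure K →ₐ[K] AlgebraicClosure E)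
  (W : WeierstrassCurve K)

/-- **The strict minus group is `p^j`-saturated in `E(K_n·E)`** (Lemma 8.17 for the signed part,
`Tr_{n/0}(p^j w) = p^j Tr_{n/0} w` torsion ⟹ `Tr_{n/0} w` torsion for the clause).
[cite: Kobayashi2003, Lemma 8.17 (p. 19), Def. 2.1 (p. 5)] -/
theorem mem_strictSigned_of_pow_smul_mem (n j : ℕ)
    (htors : ∀ P ∈ localLayerPointsOfEmb κ ι W n, p • P = 0 → P = 0)
    {w : localPoints W E} (hw : w ∈ localLayerPointsOfEmb κ ι W n)
    (hpw : p ^ j • w ∈ strictSignedLocalPointsOfEmb κ ι W (-1) n) :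
    w ∈ strictSignedLocalPointsOfEmb κ ι W (-1) n := by
  rw [mem_strictSignedLocalPointsOfEmb_iff] at hpw ⊢
  obtain ⟨hs, hk⟩ := hpw
  have htors' : ∀ P ∈ localLayerPointsOfEmb κ ι W n, p ^ j • P = 0 → P = 0 :=
    noTorsion_pow (localLayerPointsOfEmb κ ι W n) htors j
  refine ⟨?_, fun hε ↦ ?_⟩
  · rw [signedLocalPointsOfEmb_eq_towerSigned] at hs ⊢
    exact towerSignedLocalPointsOfEmb_saturated ι W κ.layerSubgroup κ.layerSubgroup_antitone (-1) n
      htors' hw hs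
  · have h := hk hε
    rw [map_nsmul] at h
    rw [AddCommGroup.mem_torsion, isOfFinAddOrder_iff_nsmul_eq_zero] at h ⊢
    obtain ⟨N, hN, hN0⟩ := h
    exact ⟨N * p ^ j, Nat.mul_pos hN (pow_pos hp.out.pos j), by rw [mul_nsmul', hN0]⟩

end Saturation

section Vanishing

variable {G : Type*} [Group G] {M : Type*} [AddCommGroup M] [DistribMulAction G M]

/-- A crossed homomorphism vanishing on a normal subgroup `N` takes `N`-invariant values
(`n • f(u) = f(n u) − f(n) = f(u · u⁻¹ n u) = f(u)`). [cite: SerreGaloisCohomology1997, I.§5.8] -/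
theorem smul_eq_of_crossedHom_of_vanishing (f : G → M) (hf : ∀ u v : G, f (u * v) = f u + u • f v)
    (N : Subgroup G) [hN : N.Normal] (hfN : ∀ n ∈ N, f n = 0) (u : G) {n : G} (hn : n ∈ N) :
    n • f u = f u := by
  have h1 : f (n * u) = n • f u := by rw [hf, hfN n hn, zero_add]
  have h2 : f (u * (u⁻¹ * n * u)) = f u := by
    rw [hf, hfN _ (hN.conj_mem' n hn u), smul_zero, add_zero]
  rw [← h1, show n * u = u * (u⁻¹ * n * u) by group, h2]

end Vanishing

section Main

variable {K : Type u} [Field K] (W : WeierstrassCurve K) (p : ℕ) [hp : Fact p.Prime] (m : ℕ)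
  (E : Type u) [Field E] [Algebra K E] (κ : ZpExtension K p)

/-- **From the `K_∞`-signed condition to a finite layer (hypothesis (a) of the receptacle bridge).**
If `h_0(Ψ_m c)` lies in `localKummerOverOfEmb W p (ker κ) (closureEmb E) (⨆_n E^{−,str}(K_n·E))`,
`E(K_∞·E)` has no `p`-power torsion and the layers `E(K_n·E)` have no `p`-torsion, then for some
layer `n`, some strict minus point `x ∈ E^{−,str}(K_n·E)` and some `R` with `p^m R = x`, the class
`res_E c ∈ H¹(E, E[p^m])` is represented by a cocycle with values `u ↦ u•R − R` on `Gal(K̄_E/K_n·E)`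
(the crossed homomorphism `u ↦ φ₀(u|_K̄) − (uR − R)` vanishes on `Gal(K̄_E/K_∞·E)`, hence takes
`E(K_∞·E)`-values, which are `p`-power torsion on `Gal(K̄_E/K_n·E)`, hence zero). So the
localisations of `A₀ = Sel^{loc,∞}` lie in any receptacle made of such classes.
[cite: Kobayashi2003, Def. 2.1 (p. 5), Prop. 8.7 (p. 16), Lemma 8.17 (p. 19), §9]
[cite: GreenbergLNM1716, §3 pp. 85–86] -/
theorem exists_kummer_cocycle_of_mem_localKummerOverOfEmb_iSup_strictSigned
    (htors : ∀ n, ∀ P ∈ localLayerPointsOfEmb κ (closureEmb (K := K) E) W n, p • P = 0 → P = 0)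
    (htorsInf : ∀ P ∈ localFixedPointsOfEmb (closureEmb (K := K) E) W κ.kerSubgroup,
      ∀ j : ℕ, p ^ j • P = 0 → P = 0)
    (c : galoisCohomology (W.torsionGaloisModule ((p ^ m : ℕ) : ℤ)) 1)
    (hc : resH1Hom (subgroupIncl κ.kerSubgroup) (AddMonoidHom.id (geomPrimaryTorsion W p))
        (fun _ _ ↦ rfl) (galoisCohomology.map (primaryInclusion W p m) 1 c) ∈
      localKummerOverOfEmb W p κ.kerSubgroup (closureEmb (K := K) E)
        (⨆ n, strictSignedLocalPointsOfEmb κ (closureEmb (K := K) E) W (-1) n)) :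
    ∃ n : ℕ, ∃ x ∈ strictSignedLocalPointsOfEmb κ (closureEmb (K := K) E) W (-1) n,
      ∃ R : localPoints W E, ((p ^ m : ℕ) : ℤ) • R = x ∧
      ∃ φ : contOneCocycles (DiscreteGaloisModule.toTopRep
          (GaloisRep.restrictField E (W.torsionGaloisModule ((p ^ m : ℕ) : ℤ)))),
        galoisCohomology.res (W.torsionGaloisModule ((p ^ m : ℕ) : ℤ)) E 1 c = oneCocycleClass _ φ ∧
        ∀ u ∈ localLayerSubgroupOfEmb κ (closureEmb (K := K) E) n,
          pointsMap W E ((φ.1 u : geomTorsion W ((p ^ m : ℕ) : ℤ)) : geomPoints W) = u • R - R := by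
  set ι := closureEmb (K := K) E with hι
  obtain ⟨φ₀, rfl⟩ := oneCocycleClass_surjective _ c
  obtain ⟨φ', Q, k, hφ', hQ, hτ⟩ := (mem_localKummerOverOfEmb_iff _ _).mp hc
  rw [galoisCohomology.map_one_oneCocycleClass] at hφ'
  erw [map_oneCocycleClass] at hφ'
  rw [eq_comm] at hφ'
  have h0 := sub_eq_zero.mpr hφ'
  rw [← oneCocycleClass_sub] at h0
  obtain ⟨T₀, hT₀⟩ := (oneCocycleClass_eq_zero_iff _ _).mp h0
  -- the coboundary defect, read on points of `E(K̄_E)`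
  set T₀' : localPoints W E := pointsMapOfEmb W ι ((T₀ : geomPrimaryTorsion W p) : geomPoints W)
    with hT₀'
  have h1 : ∀ τ : localSubgroupOfEmb κ.kerSubgroup ι,
      pointsMapOfEmb W ι ((φ₀.1 (resGalOfEmb ι τ) : geomTorsion W _) : geomPoints W) -
        pointsMapOfEmb W ι ((φ'.1 (resGalSubgroupOfEmb κ.kerSubgroup ι τ) :
          geomPrimaryTorsion W p) : geomPoints W) =
      (τ : absoluteGaloisGroup E) • T₀' - T₀' := by
    intro τ
    have h := congrArg (fun z : geomPrimaryTorsion W p => pointsMapOfEmb W ι (z : geomPoints W))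
      (hT₀ (resGalSubgroupOfEmb κ.kerSubgroup ι τ))
    change pointsMapOfEmb W ι
        (((φ₀.1 (resGalOfEmb ι τ) : geomTorsion W _) : geomPoints W) -
          ((φ'.1 (resGalSubgroupOfEmb κ.kerSubgroup ι τ) : geomPrimaryTorsion W p) : geomPoints W)) =
      pointsMapOfEmb W ι
        (resGalOfEmb ι (τ : absoluteGaloisGroup E) • ((T₀ : geomPrimaryTorsion W p) : geomPoints W) -
          ((T₀ : geomPrimaryTorsion W p) : geomPoints W)) at h
    rw [map_sub, map_sub, pointsMapOfEmb_smul] at h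
    exact h
  -- the Kummer point seen by `φ₀` on `Gal(K̄_E/K_∞·E)`
  set Q' : localPoints W E := Q + T₀' with hQ'
  have h2 : ∀ τ : localSubgroupOfEmb κ.kerSubgroup ι,
      pointsMapOfEmb W ι ((φ₀.1 (resGalOfEmb ι τ) : geomTorsion W _) : geomPoints W) =
        (τ : absoluteGaloisGroup E) • Q' - Q' := by
    intro τ
    have h := h1 τ
    rw [hτ τ, sub_eq_iff_eq_add] at h
    rw [h, hQ', smul_add]
    abel
  -- the cocycle identity of `φ₀` on points
  have hcoc : ∀ a b : absoluteGaloisGroup K,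
      ((φ₀.1 (a * b) : geomTorsion W _) : geomPoints W) =
        ((φ₀.1 a : geomTorsion W _) : geomPoints W) + a • ((φ₀.1 b : geomTorsion W _) : geomPoints W) := by
    intro a b
    have h := congrArg (fun z : geomTorsion W ((p ^ m : ℕ) : ℤ) => (z : geomPoints W)) (φ₀.2 a b)
    simp only at h
    rw [AddMemClass.coe_add] at h
    exact h
  -- the defect crossed homomorphism `f(u) = ι(φ₀(u|_K̄)) − (uQ' − Q')`
  set f : absoluteGaloisGroup E → localPoints W E := fun u =>
    pointsMapOfEmb W ι ((φ₀.1 (resGalOfEmb ι u) : geomTorsion W _) : geomPoints W) - (u • Q' - Q')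
    with hf
  have hfcoc : ∀ u v : absoluteGaloisGroup E, f (u * v) = f u + u • f v := by
    intro u v
    simp only [hf]
    rw [map_mul, hcoc, map_add, pointsMapOfEmb_smul, mul_smul, smul_sub, smul_sub]
    abel
  have hfN : ∀ n ∈ localSubgroupOfEmb κ.kerSubgroup ι, f n = 0 := by
    intro n hn
    simp only [hf]
    rw [h2 ⟨n, hn⟩, sub_self]
  haveI : κ.kerSubgroup.Normal := MonoidHom.normal_ker _
  haveI hNn : (localSubgroupOfEmb κ.kerSubgroup ι).Normal := normal_localSubgroupOfEmb ι κ.kerSubgroup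
  have hfix : ∀ u : absoluteGaloisGroup E, f u ∈ localFixedPointsOfEmb ι W κ.kerSubgroup := by
    intro u
    rw [mem_localFixedPointsOfEmb_iff]
    intro n hn
    exact smul_eq_of_crossedHom_of_vanishing f hfcoc _ hfN u hn
  -- the layer `n₁` where `p^k Q` lives, and the exponent `j` killing `T₀`
  obtain ⟨n₁, hn₁⟩ := (mem_iSup_strictSignedLocalPointsOfEmb_iff κ ι W (-1) _).mp hQ
  obtain ⟨j, hj⟩ := T₀.2
  have hjT : p ^ j • T₀' = 0 := by
    rw [hT₀', ← map_nsmul]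
    erw [hj]
    rw [map_zero]
  have hkQn : p ^ k • Q ∈ localLayerPointsOfEmb κ ι W n₁ :=
    strictSignedLocalPointsOfEmb_le_localLayerPoints κ ι W (-1) n₁ hn₁
  have hkjQ' : p ^ (k + j) • Q' = p ^ j • (p ^ k • Q) := by
    rw [hQ', smul_add, pow_add, mul_comm, mul_nsmul', mul_nsmul', smul_comm (p ^ j) (p ^ k) T₀', hjT,
      smul_zero, add_zero]
  -- `f` vanishes on `Gal(K̄_E/K_{n₁}·E)`: its values are `p`-power torsion in `E(K_∞·E)`
  have hkey : ∀ u ∈ localLayerSubgroupOfEmb κ ι n₁,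
      pointsMapOfEmb W ι ((φ₀.1 (resGalOfEmb ι u) : geomTorsion W _) : geomPoints W) = u • Q' - Q' := by
    intro u hu
    have huQ : u • (p ^ (k + j) • Q') = p ^ (k + j) • Q' := by
      rw [hkjQ', smul_comm u (p ^ j) (p ^ k • Q), (mem_localLayerPointsOfEmb_iff κ ι W n₁ _).mp hkQn u hu]
    have htor : p ^ (m + (k + j)) • f u = 0 := by
      simp only [hf]
      rw [smul_sub, pow_add, mul_comm, mul_nsmul', ← map_nsmul, ← AddSubgroupClass.coe_nsmul,
        pow_nsmul_geomTorsion_eq_zero W p m, ZeroMemClass.coe_zero, map_zero, smul_zero, zero_sub,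
        neg_eq_zero, mul_comm, mul_nsmul', smul_sub, ← smul_comm u, huQ, sub_self, smul_zero]
    have h0 : f u = 0 := htorsInf (f u) (hfix u) _ htor
    simp only [hf] at h0
    exact sub_eq_zero.mp h0
  -- the point `x = p^m Q'` is a strict minus point of layer `n₁`
  have hxlayer : p ^ m • Q' ∈ localLayerPointsOfEmb κ ι W n₁ := by
    rw [mem_localLayerPointsOfEmb_iff]
    intro u hu
    have h := hkey u hu
    have h0 : p ^ m • (u • Q' - Q') = 0 := by
      rw [← h, ← map_nsmul, ← AddSubgroupClass.coe_nsmul, pow_nsmul_geomTorsion_eq_zero W p m,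
        ZeroMemClass.coe_zero, map_zero]
    rw [smul_sub, sub_eq_zero, smul_comm] at h0
    exact h0
  have hxstrict : p ^ m • Q' ∈ strictSignedLocalPointsOfEmb κ ι W (-1) n₁ := by
    refine mem_strictSigned_of_pow_smul_mem κ ι W n₁ (k + j) (htors n₁) hxlayer ?_
    rw [smul_comm, hkjQ']
    exact AddSubgroup.nsmul_mem _ (AddSubgroup.nsmul_mem _ hn₁ _) _
  -- the representative of `res_E c`
  set ψE : contOneCocycles (DiscreteGaloisModule.toTopRep
      (GaloisRep.restrictField E (W.torsionGaloisModule ((p ^ m : ℕ) : ℤ)))) :=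
    contOneCocycles.pullback (absGaloisRestrict K E)
      (Y := DiscreteGaloisModule.toTopRep
        (GaloisRep.restrictField E (W.torsionGaloisModule ((p ^ m : ℕ) : ℤ))))
      (TopRep.ofHom ⟨ContinuousLinearMap.id ℤ _, fun _ => rfl⟩) φ₀ with hψE
  refine ⟨n₁, p ^ m • Q', hxstrict, Q', natCast_zsmul Q' (p ^ m), ψE, ?_, fun u hu ↦ ?_⟩
  · unfold galoisCohomology.res galoisCohomology.pullback
    erw [map_oneCocycleClass]
    rfl
  · change pointsMapOfEmb W ι ((φ₀.1 (absGaloisRestrict K E u) : geomTorsion W _) : geomPoints W) = _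
    rw [← resGal_eq_absGaloisRestrict, resGal_eq, ← hι]
    exact hkey u hu

end Main

end Summit.BirchSwinnertonDyer.Rank1Residual.Additive.LevelBridge

end
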